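import Literature.NumberTheory.Automorphic.ConjugateSelfDualInfinityType
import Literature.AlgebraicGeometry.Liu2021.AdmissibleElement
import Mathlib.RepresentationTheory.Basic
import Mathlib.Algebra.DirectSum.Module
import Mathlib.RingTheory.TensorProduct.Basic
import HarnessLib

/-!
# Liu 2021, Theorem 4.18 — EXACTLY AS PRINTED (statement-exact typing; no proof)

[Liu2021] = Yifeng Liu, *Fourier–Jacobi cycles and arithmetic relative trace formula* (with an appendix by Chao Li
and Yihang Zhu), Cambridge J. Math. **9** (2021), no. 1, 1–147 = arXiv:2102.11518.  PRIMARY SOURCE READ FOR THIS FILE: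
the author's TeX source of the arXiv v2 e-print, `FJcycle.tex` (md5 `6db49a74122d2cb0f224fa1b39488a0c`, 7163 lines; held
at `run/shared/lean/pub/pub-hodgecm/pub-hodgecm-cf-kudla-howe-rallis-g4/lit/Liu21-arxiv-src/FJcycle.tex`) — every
`l. NNNN` below is a line of that file; cross-references `pNNNN Lk` are to the held extraction `paper:arxiv-2102.11518`
(68 chunks; chunk numbers are NOT journal pages).  Theorem numbers are those of the compiled arXiv v2 = the Cambridge
J. Math. numbering (author's arXiv comment; 25/25 numbered secondary citations agree — finding F-11 of the cell's second
Liu seat); Cambridge J. Math. PAGE numbers are not held (acquisition `acq-07613` open) and are not quoted.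

## What this file is

The coordinator's ruling of 2026-08-21T13:05:07Z («STATEMENT-EXACT TYPINGS») asks for Theorem 4.18 «EXACTLY AS
PRINTED: every printed hypothesis an explicit binder, quantifiers exactly as the paper has them, docstring quoting
page + line; NO proof».  This file is that typing.  It differs in kind from the tree's earlier records of the same
theorem — `Literature.AlgebraicGeometry.Liu2021.LiuAlbaneseCMDatum.Thm418` (the main statement read as a
MULTIPLICITY count over bare index carriers), `….Thm418_1` (item (1) as an equality of `ℚ`-dimensions),
`….LiuAlbaneseDatum.Thm418_2` (item (2) as injectivity of an index map), and from the stage-1 package's COMBINED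
READING r8 `HodgeCM.Literature.Theta.LiuAlbaneseModuleDatum.Thm418Combined` / `LiuDictionary.Thm418C` (a consequence
of Thm. 4.18 + its proof map (4.2) + item (1) + Rem. 4.17 + Lem. 2.4 (1), stated on an intrinsic isotypic block) — in
that (i) the number-field layer (`F`, `E/F`, the character `μ`, its CM type `Φ_μ`, the field `M_μ ⊆ ℂ`, the Galois
group `Gal(ℂ/M_μ)`, `μ`-admissibility of `ε` through an element `e ∈ E^{×−}`) is typed on REAL Mathlib / tree
objects, (ii) the conclusion is typed as the printed ISOMORPHISM OF `ℂ[𝔾(𝔸_F^∞)]`-MODULES `Ω(μ) ⊗_{M_μ} ℂ ≃ ⊕_{ε,χ}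
ω(μ,ε,χ)` (a `ℂ`-linear equivalence intertwining the two group actions) together with items (1), (2), (3) in the same
sentence, and (iii) nothing is combined with the proof or with other numbered results.

## What a CARRIER is (read this before auditing)

Mathlib and the tree do not construct: incoherent hermitian spaces over `𝔸_E` and their unitary groups, the Shimura
varieties `Sh(𝕍)_K`, their compactifications `X_K`, Albanese varieties `A_K`, the pro-object `A_∞` with its Hecke action,
`Hom`-groups of abelian varieties over `E`, adèlic oscillator representations, the category `𝒜(μ)` of CM data.  Every
such object that the printed sentence NAMES is therefore a field of the hypothesis structure `Thm418Data` below, marked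
**⟨CARRIER⟩** in its docstring, which quotes the printed DEFINITION of the object with its TeX line.  A carrier is DATA
supplied by a consumer; `Thm418AsPrinted D` is a PREDICATE on the datum `D`; NOTHING IS ASSERTED here.  A consumer cites
the theorem by taking `(h : D.Thm418AsPrinted)` (or `(h : Thm418AsPrinted D)`) for ITS OWN datum `D`, and an auditor
checks that each carrier of that `D` is instantiated with the printed object.  The closed sentence
`∀ D, Thm418AsPrinted D` is NOT Liu's theorem (it is false on degenerate carriers, e.g. `Ω := 0` with a non-zero
`ω(μ,ε,χ)`), and no declaration of this file has that type.  Fields NOT marked ⟨CARRIER⟩ are genuine Lean objects or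
genuine hypotheses (the printed hypotheses on `F`, `E`, `n`, `μ`).

## The printed text (verbatim from `FJcycle.tex`, TeX macros resolved: `\bV` = `𝕍`, `\bG` = `𝔾`, `\bA` = `𝔸`, `\dC` = `ℂ`,
`\dQ` = `ℚ`, `\cA(\mu)` = `𝒜(μ)`, `\tc` = `c`, `\Nm` = `Nm`, `\r{B}` = `B`)

**Standing hypotheses of §4** («Fourier–Jacobi cycles and derivative of L-functions», TeX label `ss:3`), l. 1878
(= p0018 L5): «Let `F` be a totally real number field of degree `d ≥ 1`, and `E/F` a totally imaginary quadratic
extension.»  l. 1880–1890: «We denote by `c` the nontrivial Galois involution of `E` over `F`, `E^−` the subgroup of `E`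
consisting of `e` satisfying `e + e^c = 0`, and `E^1` the subgroup of `E^×` consisting of `e` satisfying `e e^c = 1`,
by `μ_{E/F} : F^× \ 𝔸_F^× → ℂ^×` the quadratic character associated to `E/F` via the global class field theory, `E_v`
the base change `E ⊗_F F_v` for every place `v` of `F`, `Φ_F` the set of real embeddings of `F`, `Φ_E` the set of complex
embeddings of `E`, and `π : Φ_E → Φ_F` the projection map given by restriction.  Recall that a CM type (of `E`) is a
subset `Φ` of `Φ_E` such that `π` induces a bijection from `Φ` to `Φ_F`.»

**§4.1, Def. 4.1** (l. 1900–1902 = p0018 L25–26): «We say that an automorphic character `μ : E^× \ 𝔸_E^× → ℂ^×` is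
*conjugate self-dual* if `μ` is trivial on `Nm_{𝔸_E/𝔸_F} 𝔸_E^×`. We say that `μ` is *conjugate orthogonal* (resp.
*conjugate symplectic*) if `μ|_{𝔸_F^×} = 1` (resp. `μ|_{𝔸_F^×} = μ_{E/F}`).»  l. 1908–1912 (p0018 L31–35): «For a
conjugate symplectic (resp. conjugate orthogonal) automorphic character `μ`, there exist a CM type `Φ_μ` and a unique
tuple `𝚠_μ = (𝚠_τ)_{τ ∈ Φ_F}` of odd (resp. even) nonnegative integers such that for every `τ ∈ Φ_F`, the component
`μ_τ : (E ⊗_{F,τ} ℝ)^× → ℂ^×` is the character `z ↦ arg(z)^{−𝚠_τ}`, where we have identified `(E ⊗_{F,τ} ℝ)^×` with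
`ℂ^×` via the unique element `τ' ∈ Φ_μ` above `τ`. If `𝚠_μ` does not contain `0`, then `Φ_μ` is also unique.»
**Def. 4.3** (l. 1914–1921 = p0018 L37–42): «Let `μ` be a conjugate self-dual automorphic character. (1) We call `𝚠_μ`
the *weight* of `μ`. If `𝚠_μ` is a constant `m`, then we say that `μ` is of weight `m`. (2) If `𝚠_μ` does not contain
zero, then we call `Φ_μ` the *CM type* of `μ`. Furthermore, we denote by `M'_μ ⊆ ℂ` the reflex field of `(E, Φ_μ)`,
with the induced CM type `Ψ_μ`.»  l. 1924–1928 (p0018 L44–48): «Now let `μ` be a conjugate symplectic automorphic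
character, which is not algebraic. We put `μ^{alg} := μ · |·|_E^{−1/2}`, which is then algebraic. Denote by `M_μ ⊆ ℂ`
the subfield generated by values `μ^{alg}(x)` for `x ∈ (𝔸_E^∞)^×`, which is a number field containing `M'_μ`.»
(`|·|_E^s := |·|_ℚ^s ∘ Nm_{E/ℚ}`, `|·|_ℚ` the idelic norm trivial on `\hat ℤ^×`, l. 1130.)

**Def. 4.5** (l. 1936–1964 = p0018 L53–77): «Let `μ` be a conjugate symplectic automorphic character of weight one.
(1) […] `η_μ := η'_μ ∘ Nm_{M_μ/M'_μ}` […]. (2) We define a *CM data for `μ`* to be a quadruple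
`D_μ = (A_μ, i_μ, λ_μ, r_μ)`, in which • `A_μ` is an abelian variety over `E`, • `i_μ : M_μ → End_E(A_μ)_ℚ` is a CM
structure such that – for every `x ∈ M_μ`, the determinant of the action of `i_μ(x)` on the `E`-vector space
`Lie_E(A_μ)` equals `η_μ(x)`, – the associated CM character of `A_μ` with respect to the inclusion `M_μ ↪ ℂ` coincides
with `μ^{alg}`, • `λ_μ : A_μ → A_μ^∨` is a polarization satisfying `λ ∘ i_μ(x) = i_μ(\bar x)^∨ ∘ λ` for every `x ∈ M_μ`,
• `r_μ : M_μ ⊗_ℚ E → H_1^{dR}(A_μ/E)` is an isomorphism of `M_μ ⊗_ℚ E`-modules satisfying [a trace condition on the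
`λ`-pairing]. (3) We denote by `𝒜(μ)` the *category of CM data for `μ`*, whose objects are CM data `D_μ`, and morphisms
[…] are isogenies `φ : A_μ → A'_μ` [compatible with `i`, `λ` up to `ℚ^×`, `r`].»  **Prop. 4.6 (1)** (l. 1969): «The
category `𝒜(μ)` is a nonempty and connected partially ordered set.»

**§4.2 «Albanese of unitary Shimura varieties», standing data**, l. 2053–2058 (= p0020 L1–5): «Let `n ≥ 2` be an
integer. Let `𝕍` be a totally definite incoherent hermitian space over `𝔸_E` of rank `n` (Definition C.3). We distinguish
between two cases: [Noncompact Case] `d = 1`, and either `n ≥ 3` or `n = 2` and the hermitian space `𝕍 ⊗_𝔸 ℚ_p` is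
isotropic for every rational prime `p`. [Compact Case] if it is not in the Noncompact Case.»  l. 2060–2064 (p0020 L7–11):
«Let `𝔾 := U(𝕍)` be the unitary group of `𝕍`, which is a reductive group over `𝔸_F`. Let `{Sh(𝕍)_K}_K` be the projective
system of Shimura varieties for `𝕍` indexed by sufficiently small open compact subgroups `K` of `𝔾(𝔸_F^∞)` (Definition
C.6). Every scheme `Sh(𝕍)_K` is smooth, quasi-projective, and of dimension `n − 1` over `E`; it is projective if and only
if we are in the Compact Case. In all cases, we have the compactified Shimura variety `\tilde Sh(𝕍)_K` (Definition C.8).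
Put `X_K := \tilde Sh(𝕍)_K` for short.»  l. 2066–2074 (p0020 L13–21): «We denote by `A_K` the Albanese variety
`Alb_{X_K}` of `X_K` (Definition 2.3) for short […]. By functoriality, we obtain a projective system `{A_K}_K`. Put
`A_∞ := lim_K A_K`, which is an abelian group pro-object in `Sch_{/E}`. Then the Hecke correspondences provide a
homomorphism `𝔾(𝔸_F^∞) → Aut_E(A_∞)`.»  **Def. C.3** (l. 4614–4616): «An *incoherent hermitian space* over `𝔸_E` is a
free `𝔸_E`-module `𝕍` of some rank `n ≥ 1`, equipped with a non-degenerate hermitian form `( , )_𝕍 : 𝕍 × 𝕍 → 𝔸_E`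
with respect to the (induced) involution `c` on `𝔸_E` such that its determinant belongs to
`𝔸_F^× ∖ F^× Nm_{𝔸_E/𝔸_F} 𝔸_E^×`. We say that `𝕍` is totally positive definite if for every `τ ∈ Φ_F`, `𝕍 ⊗_{𝔸_F,τ} ℝ`
is positive definite.» (§4.2 writes «totally definite»; Def. C.3 defines «totally positive definite» — the same notion.  The
held extraction numbers the items of Appendices A–D as 7.x–10.x: Def. C.3 = its ‘Definition 9.3’ p0049 L61, Def. C.4 =
‘9.4’, Prop. C.5 = ‘9.5’, Def. C.6 = ‘9.6’, Def. C.8 = ‘9.8’, Lem. D.1 = ‘10.1’.)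

**Def. 4.11** (l. 2083–2097 = p0020 L29–42): «An *adèlic oscillator triple* is a triple `(μ, ε, χ)` consisting of • a
conjugate symplectic automorphic character (Definition 4.1) `μ = ⊗ μ_v : E^× \ 𝔸_E^× → ℂ^×` (whose value is
necessarily in `ℂ^1`), • a collection `ε = (ε_v ∈ E_v^{−×} / Nm_{E_v/F_v} E_v^×)_v` for every nonarchimedean place `v`
of `F` such that `ε_v ∈ O_{E_v}^× Nm_{E_v/F_v} E_v^×` for all but finitely many `v`, and • an automorphic character
`χ = ⊗ χ_v : E^1 \ (𝔸_E^∞)^1 → ℂ^×` (whose value is necessarily in `ℂ^1`).  For an adèlic oscillator triple `(μ, ε, χ)`,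
the local oscillator representation `ω(μ_v, ε_v, χ_v)` of `𝔾(F_v)` introduced in Subsection D.1 is unramified for all
but finitely many `v`. Thus, it makes sense to define the *adèlic oscillator representation* attached to `(μ, ε, χ)`,
`ω(μ, ε, χ) := ⊗'_v ω(μ_v, ε_v, χ_v)`, which is an irreducible admissible representation of `𝔾(𝔸_F^∞)`.»
**Def. 4.12** (l. 2102–2110 = p0020 L44–51): «In an adèlic oscillator triple `(μ, ε, χ)`, we say that `ε` is
*`μ`-admissible* if there exists some `e ∈ E^{×−}` such that • `ε_v = e Nm_{E_v/F_v} E_v^×` for every nonarchimedean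
place `v` of `F`, and • `τ'(e)` has negative imaginary part for every `τ' ∈ Φ_μ`.  It is clear by Remark 4.4 that `ε` is
`μ`-admissible if and only if `−ε` is `μ^c`-admissible.»

**Def. 4.16** (l. 2218–2224 = p0022 L50–55): «Let `μ : E^× \ 𝔸_E^× → ℂ^×` be a conjugate symplectic character of
weight one. For every object `D_μ = (A_μ, i_μ, λ_μ, r_μ) ∈ 𝒜(μ)` (Definition 4.5), the `ℚ`-vector space
`Hom_E(A_∞, A_μ)_ℚ` is an `M_μ[𝔾(𝔸_F^∞)]`-module, where `M_μ` acts via `i_μ` and `𝔾(𝔸_F^∞)` acts `M_μ`-linearly via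
its action on `A_∞`. Put `Ω(μ) := colim_{D_μ ∈ 𝒜(μ)} Hom_E(A_∞, A_μ)_ℚ` in the category of
`M_μ[𝔾(𝔸_F^∞)]`-modules.»  **Rem. 4.17** (l. 2226–2228 = p0022 L56–57): «It follows from Proposition 4.6 (1) that for
every object `D_μ = (A_μ, i_μ, λ_μ, r_μ) ∈ 𝒜(μ)`, the canonical map `Hom_E(A_∞, A_μ)_ℚ → Ω(μ)` is an isomorphism.»

**THEOREM 4.18** (TeX label `th:cm_albanese`, l. 2232–2245 = p0022 L59–70), VERBATIM:
«There is an isomorphism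
    `Ω(μ) ⊗_{M_μ} ℂ ≃ ⊕_ε ⊕_χ ω(μ, ε, χ)`
of `ℂ[𝔾(𝔸_F^∞)]`-modules, where the direct sum is taken over all `ε, χ` such that `ε` is `μ`-admissible. Moreover,
 (1) For every object `D_μ = (A_μ, i_μ, λ_μ, r_μ) ∈ 𝒜(μ)`, we have a canonical isomorphism `Ω(μ)^K ≃ Hom_E(A_K, A_μ)_ℚ`
     for every sufficiently small open compact subgroup `K ⊆ 𝔾(𝔸_F^∞)`.  [l. 2239]
 (2) The `ℂ[𝔾(𝔸_F^∞)]`-modules in the direct sum in Theorem 4.18 are mutually non-isomorphic.  [l. 2241]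
 (3) For every given `ε` that is `μ`-admissible, the subspace `⊕_χ ω(μ, ε, χ)` is stable under the action of
     `Gal(ℂ/M_μ)`.  [l. 2243]»

NOT printed in the statement (and therefore NOT binders here): `n ≥ 3` (the proof, l. 2263, treats `n ≥ 3` and `n = 2`
separately: Prop. 4.13 + Thm. 4.15, resp. Prop. D.4 (1) + Rem. D.5 + Thm. D.6 (1)); `τ' ∈ Φ_μ` (an embedding
`τ' ∈ Φ_μ` is CHOSEN in the proof, l. 2250, and the isomorphism «depends only on `α`, not on `ℓ`, `ι_ℓ`, and `τ'`»,
l. 2268); any condition on the degree `d` beyond `d ≥ 1`, any Galois or normal-closure condition on `E` or `F`, the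
Compact Case, any signature datum (the signatures of `𝕍` are fixed by «totally positive definite»), any
ramification / conductor / temperedness / `L`-value condition (none occurs in §4.1–4.2 before Thm. 4.18).

## The typing (paper order; `⟨CARRIER⟩` = posited datum, see above)

* `F`, `E`: `[NumberField F] [IsTotallyReal F] [NumberField E] [Algebra F E] [IsTotallyComplex E]
  [Algebra.IsQuadraticExtension F E]` — l. 1878, Mathlib's CM-extension vocabulary (`Mathlib.NumberTheory.NumberField.CMField`,
  section `CMExtension`).  «of degree `d ≥ 1`» is automatic (`Module.finrank ℚ F ≥ 1` for a number field) and is recorded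
  as the lemma `one_le_finrank`.  CONSEQUENCE used below: `E` is a CM field in Mathlib's sense, `NumberField.IsCMField E`
  (`IsCMField.ofCMExtension F E`), with `F ≃ E⁺ := maximalRealSubfield E` over `E` (`CMExtension.equivMaximalRealSubfield`);
  the tree's character vocabulary is phrased with `E⁺` and is transported along this canonical identification (READING R1).
* `n`, `2 ≤ n` — l. 2053.
* ⟨CARRIER⟩ `𝕍` (a bare token type) = the totally (positive) definite incoherent hermitian space over `𝔸_E` of rank `n`
  — l. 2053; Def. C.3 quoted on the field — and ⟨CARRIER⟩ `G` (a topological group) = `𝔾(𝔸_F^∞)`, `𝔾 = U(𝕍)` — l. 2060.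
  No adèlic hermitian spaces exist in Mathlib / the tree: `𝕍`'s printed attributes (rank `n`, incoherent, totally positive
  definite) are part of the MEANING of the two carriers and no structure on `𝕍` is used (the statement sees `𝕍` only
  through `G`).  «Sufficiently small open compact subgroup `K ⊆ 𝔾(𝔸_F^∞)`» is typed
  on `G`'s topology: `IsOpenCompact K := IsOpen K ∧ IsCompact K`, and «for every sufficiently small …» =
  `∃ K₀ open compact, ∀ K open compact, K ≤ K₀ → …` (READING R2, the standard meaning of the phrase).
* ⟨CARRIER⟩ `Eps` = the collections `ε` of Def. 4.11 (second bullet); ⟨CARRIER⟩ `epsOf : E → Eps`, `e ↦ (e Nm_{E_v/F_v}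
  E_v^×)_v` (Def. 4.12, first bullet; only its values on `E^{×−}` matter); ⟨CARRIER⟩ `Chi` = the automorphic characters
  `χ` of `E^1 \ (𝔸_E^∞)^1` (Def. 4.11, third bullet).
* `μ : IdeleClassGroup E →ₜ* Circle` — REAL: a continuous unitary character of `C_E = E^× \ 𝔸_E^×` (the tree's
  `Literature.NumberTheory.Automorphic.IdeleClassGroup`; «automorphic character … whose value is necessarily in `ℂ^1`»),
  with the two printed hypotheses `IsConjugateSymplectic E μ` (Def. 4.1, tree `IdeleClassGroup.IsConjugateSymplectic`:
  `μ|_{C_{E⁺}} = μ_{E/E⁺}`) and `HasWeight E μ 1` (Def. 4.3 «of weight `1`», tree `IdeleClassGroup.HasWeight`) — Def. 4.16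
  l. 2219.  `Φ_μ` is then the tree's `IsConjugateSymplectic.cmType` (Def. 4.3 (2); a `Motives.CMType E`).
* `μ^{alg}` and `M_μ` — REAL, DEFINED here from `μ` exactly as printed (l. 1924–1928): `muAlgValue μ x = μ(x)·‖x‖_E^{−1/2}`
  for an idele `x` (tree `IdeleClassGroup.ideleNorm` = `|·|_E`), and `fieldOfValues μ = M_μ :=` the subfield of `ℂ`
  generated by the `μ^{alg}(x)`, `x` a FINITE idele (`x_∞ = 1`), as an `IntermediateField ℚ ℂ`.  That `M_μ` is a number
  field (l. 1928) is not used by the statement and not proved here.  `Gal(ℂ/M_μ)` = `ℂ ≃ₐ[M_μ] ℂ` (Liu's `Gal(ℂ/k)` for a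
  subfield `k ⊆ ℂ` is the automorphism group `Aut(ℂ/k)`, cf. l. 4550 «The Galois group `Gal(ℂ/ℚ)` acts on `Φ_E`»).
* ⟨CARRIER⟩ `Obj` = the objects `D_μ = (A_μ, i_μ, λ_μ, r_μ)` of `𝒜(μ)` (Def. 4.5 (2)–(3)).
* ⟨CARRIER⟩ `omega ε χ` with `rho ε χ : Representation ℂ G (omega ε χ)` = the `ℂ[𝔾(𝔸_F^∞)]`-module `ω(μ, ε, χ)`
  (Def. 4.11; `μ` is the structure's `μ`).
* ⟨CARRIER⟩ `Ω` with `[Module M_μ Ω]` and `rhoΩ : Representation M_μ G Ω` = the `M_μ[𝔾(𝔸_F^∞)]`-module `Ω(μ)` of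
  Def. 4.16 («`M_μ` acts via `i_μ` and `𝔾(𝔸_F^∞)` acts `M_μ`-linearly»).  `Ω(μ) ⊗_{M_μ} ℂ` is Mathlib's base change
  `ℂ ⊗[M_μ] Ω` (factor order is Mathlib's convention for the `ℂ`-module structure; READING R3, harmless), with `G` acting
  by `(rhoΩ g).baseChange ℂ` and `Gal(ℂ/M_μ)` acting on the factor `ℂ` (`galoisAct σ = σ ⊗ 1`; READING R4: this is «the
  action of `Gal(ℂ/M_μ)`» of item (3) — the only action of that group on `Ω(μ) ⊗_{M_μ} ℂ` present in the text; cf. the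
  proof of (3), l. 2272: «Since `Gal(ℂ/M_μ)` stabilizes `μ` and by (2), it suffices to show …»).
* ⟨CARRIER⟩ `HomK K D` (an additive group) = `Hom_E(A_K, A_μ)_ℚ` for the object `D = D_μ` and the level `K`, with
  ⟨CARRIER⟩ `res K D : HomK K D →+ Ω` = the canonical map `Hom_E(A_K, A_μ)_ℚ → Hom_E(A_∞, A_μ)_ℚ → Ω(μ)` (composition with
  `A_∞ → A_K`, then the canonical map of Def. 4.16 / Rem. 4.17).  Item (1) «we have a canonical isomorphism
  `Ω(μ)^K ≃ Hom_E(A_K, A_μ)_ℚ`» is typed as: `res K D` is injective with image the `K`-invariants `Ω(μ)^K` (READING R5: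
  «canonical» = induced by this map; an additive bijection of `ℚ`-vector spaces is `ℚ`-linear).
* The index set of the direct sum, «all `ε, χ` such that `ε` is `μ`-admissible»: `AdmIndex D = {(ε, χ) // IsAdmissible ε}`
  with `IsAdmissible ε := ∃ e, IsAdmissibleElement E Φ_μ e ∧ epsOf e = ε` — Def. 4.12 through the tree's
  `Literature.AlgebraicGeometry.Liu2021.IsAdmissibleElement` (`e ≠ 0`, `\bar e = −e`, `Im τ'(e) < 0` for all `τ' ∈ Φ_μ`).
* «isomorphism of `ℂ[𝔾(𝔸_F^∞)]`-modules» = a `ℂ`-linear equivalence `Φ : ℂ ⊗[M_μ] Ω ≃ₗ[ℂ] ⨁_{i ∈ AdmIndex} ω_i`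
  intertwining `(rhoΩ g).baseChange ℂ` with the componentwise action of `g` (READING R6: a `ℂ[G]`-module = a `ℂ`-vector
  space with a `ℂ`-linear `G`-action; `ℂ[G]`-linear = `ℂ`-linear and `G`-equivariant).  Item (2) «mutually non-isomorphic»:
  an intertwining `ℂ`-linear equivalence `ω_i ≃ ω_j` forces `i = j`.  Item (3): for `μ`-admissible `ε`, if `Φ x` is
  supported on the indices with first coordinate `ε` then so is `Φ (σ · x)` for every `σ ∈ Gal(ℂ/M_μ)`.

READINGS R1–R6 are the only interpretive choices; each is the standard meaning of the printed words and none adds or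
removes a hypothesis.  DELTA against the package binders `h418` / `Thm418C` and the tree's `Thm418`/`Thm418_1`/`Thm418_2`:
see the cell file `run/shared/lean/pub/pub-hodgecm2/pub-hodgecm2-lit-liu-asprinted/DELTA.md`.

## References

* [Liu2021] Y. Liu, *Fourier–Jacobi cycles and arithmetic relative trace formula*, Camb. J. Math. 9 (2021) 1–147,
  arXiv:2102.11518 — §4 l. 1878–1890; Def. 4.1, 4.3, l. 1924–1928 (`μ^{alg}`, `M_μ`); Def. 4.5, Prop. 4.6 (1); §4.2
  l. 2053–2081; Def. 4.11, 4.12, 4.16, Rem. 4.17; Thm. 4.18 (l. 2232–2245); App. C Def. C.3 (l. 4614–4616).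
-/

noncomputable section

open NumberField TensorProduct DirectSum
open Literature.AlgebraicGeometry.Motives (CMType)
open Literature.AlgebraicGeometry.Liu2021 (IsAdmissibleElement)

namespace Literature.NumberTheory.Automorphic.Liu2021

/-! ## §4 preamble (l. 1878): the number fields -/

/-- «`F` … a totally real number field of degree `d ≥ 1`» (l. 1878): the degree condition is automatic for a number
field (`Module.finrank ℚ F` is positive). [cite: Liu2021, §4 l. 1878] -/
theorem one_le_finrank (F : Type) [Field F] [NumberField F] : 1 ≤ Module.finrank ℚ F := Module.finrank_pos

/-- «`E/F` a totally imaginary quadratic extension» of the totally real `F` (l. 1878) makes `E` a CM field in Mathlib's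
sense (`NumberField.IsCMField E`: totally complex, quadratic over its maximal real subfield `E⁺`), by Mathlib's
`IsCMField.ofCMExtension`; `F ≃ E⁺` canonically (`CMExtension.equivMaximalRealSubfield`).  READING R1: the tree's
character vocabulary below is phrased over `E⁺`. [cite: Liu2021, §4 l. 1878] -/
theorem isCMField (F E : Type) [Field F] [IsTotallyReal F] [Field E] [NumberField E] [Algebra F E]
    [IsTotallyComplex E] [Algebra.IsQuadraticExtension F E] : IsCMField E :=
  IsCMField.ofCMExtension F E

/-! ## `μ^{alg}` and the field `M_μ ⊆ ℂ` (l. 1924–1928), defined -/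

section MuAlg

variable (E : Type) [Field E] [NumberField E]

/-- **`μ^{alg}(x)` for an idele `x`** (l. 1924–1926: «We put `μ^{alg} := μ · |·|_E^{−1/2}`, which is then algebraic»):
the complex number `μ([x]) · |x|_E^{−1/2}`, `|·|_E` the idelic norm (tree `IdeleClassGroup.ideleNorm`, = `|·|_ℚ ∘ Nm_{E/ℚ}`
of l. 1130), `[x]` the class of `x` in `C_E = E^× \ 𝔸_E^×`.  (l. 1924 introduces `μ^{alg}` for `μ` conjugate symplectic
«which is not algebraic»: automatic for the weight-one `μ` of Thm. 4.18 — its archimedean components are `arg(z)^{∓1}`,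
odd weight, l. 1908–1910 — so no hypothesis is hidden here; the formula is written for every `μ`.)
[cite: Liu2021, §4.1 l. 1924–1926] -/
def muAlgValue (μ : IdeleClassGroup E →ₜ* Circle) (x : GaloisRepresentations.ideleGroup E) : ℂ :=
  (μ (IdeleClassGroup.mk E x) : ℂ) * (((IdeleClassGroup.ideleNorm E x : ℝ) ^ (-(1 : ℝ) / 2) : ℝ) : ℂ)

/-- **`M_μ ⊆ ℂ`** (l. 1928 = p0018 L48: «Denote by `M_μ ⊆ ℂ` the subfield generated by values `μ^{alg}(x)` for
`x ∈ (𝔸_E^∞)^×`, which is a number field containing `M'_μ`»): the subfield of `ℂ` (as an intermediate field over `ℚ`)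
generated by the values `μ^{alg}(x)`, `x` running over the FINITE ideles (ideles with archimedean component `1`).  That
it is a number field is printed but neither used nor proved here. [cite: Liu2021, §4.1 l. 1928] -/
def fieldOfValues (μ : IdeleClassGroup E →ₜ* Circle) : IntermediateField ℚ ℂ :=
  IntermediateField.adjoin ℚ
    {z : ℂ | ∃ x : GaloisRepresentations.ideleGroup E, (x : AdeleRing (𝓞 E) E).1 = 1 ∧ z = muAlgValue E μ x}

end MuAlg

/-! ## Open compact subgroups («sufficiently small open compact subgroup `K ⊆ 𝔾(𝔸_F^∞)`», l. 2060, 2239) -/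

/-- An open compact subgroup of a topological group (`𝔾(𝔸_F^∞)` is locally compact and totally disconnected; its
Shimura varieties are indexed by «sufficiently small open compact subgroups `K` of `𝔾(𝔸_F^∞)`», l. 2060; item (1) of
Thm. 4.18 quantifies over «every sufficiently small open compact subgroup `K ⊆ 𝔾(𝔸_F^∞)`», l. 2239).
[cite: Liu2021, §4.2 l. 2060 and Thm. 4.18 (1)] -/
def IsOpenCompact {G : Type} [Group G] [TopologicalSpace G] (K : Subgroup G) : Prop :=
  IsOpen (K : Set G) ∧ IsCompact (K : Set G)

/-! ## The data of Theorem 4.18, in the order the paper introduces them -/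

/-- **The data and standing hypotheses of [Liu2021, Thm. 4.18]**, in paper order, over the number fields `F ⊆ E` of
l. 1878 (parameters, with their printed hypotheses as instance arguments: `F` totally real, `E/F` totally imaginary
quadratic).  Fields marked ⟨CARRIER⟩ are posited data standing for printed objects Lean cannot construct (module
docstring, «What a CARRIER is»); the other fields are genuine objects / genuine printed hypotheses.  Nothing is asserted
by this structure. [cite: Liu2021, §4.1–4.2 (l. 1878, 2053–2074, Def. 4.1, 4.3, 4.5, 4.11, 4.12, 4.16, Rem. 4.17)] -/
structure Thm418Data (F E : Type) [Field F] [NumberField F] [IsTotallyReal F] [Field E] [NumberField E]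
    [Algebra F E] [IsTotallyComplex E] [Algebra.IsQuadraticExtension F E] : Type 1 where
  /-- «Let `n ≥ 2` be an integer» (l. 2053): the rank of `𝕍`. -/
  n : ℕ
  /-- «`n ≥ 2`» (l. 2053). -/
  two_le_n : 2 ≤ n
  /-- ⟨CARRIER⟩ (token) `𝕍`: «Let `𝕍` be a totally definite incoherent hermitian space over `𝔸_E` of rank `n`
  (Definition C.3)» (l. 2053) — Def. C.3 (l. 4614–4616): «An *incoherent hermitian space* over `𝔸_E` is a free `𝔸_E`-module
  `𝕍` of some rank `n ≥ 1`, equipped with a non-degenerate hermitian form `( , )_𝕍 : 𝕍 × 𝕍 → 𝔸_E` with respect to the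
  (induced) involution `c` on `𝔸_E` such that its determinant belongs to `𝔸_F^× ∖ F^× Nm_{𝔸_E/𝔸_F} 𝔸_E^×`. We say that `𝕍`
  is totally positive definite if for every `τ ∈ Φ_F`, `𝕍 ⊗_{𝔸_F,τ} ℝ` is positive definite.»  A bare type standing for
  the space (no adèlic hermitian spaces in Mathlib / the tree); its three printed attributes — rank `n`, incoherent,
  totally positive definite — are part of the MEANING of this token and of `G` below, and no structure on it is used by
  the statement, which sees `𝕍` only through `𝔾(𝔸_F^∞) = G`. -/
  𝕍 : Type
  /-- ⟨CARRIER⟩ `G = 𝔾(𝔸_F^∞)`, the group of finite-adèlic points of `𝔾 := U(𝕍)`, «the unitary group of `𝕍`, which is a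
  reductive group over `𝔸_F`» (l. 2060), for the `𝕍` above (a topological group: `𝔾(𝔸_F^∞)` is locally compact, totally
  disconnected).  (App. C l. 4624: for `τ ∈ Φ_F` and the `τ`-nearby hermitian space `V(τ)` over `E` — Def. C.4:
  `V(τ) ⊗_F 𝔸_F^τ ≃ 𝕍 ⊗_{𝔸_F} 𝔸_F^τ` and signature `(n−1, 1)` at `τ` — Liu FIXES an isomorphism `𝔾(𝔸_F^∞) ≃ G(τ)(𝔸^∞)`,
  `G(τ) := Res_{F/ℚ} U(V(τ))`; a consumer presenting `G` as `U(V)(𝔸_F^∞)` for such a global `V` uses that identification.) -/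
  G : Type
  [instGroup : Group G]
  [instTopologicalSpace : TopologicalSpace G]
  [instIsTopologicalGroup : IsTopologicalGroup G]
  /-- ⟨CARRIER⟩ the set of collections `ε = (ε_v ∈ E_v^{−×} / Nm_{E_v/F_v} E_v^×)_v`, `v` over the nonarchimedean places of
  `F`, «such that `ε_v ∈ O_{E_v}^× Nm_{E_v/F_v} E_v^×` for all but finitely many `v`» (Def. 4.11, second bullet,
  l. 2088).  Equality in `Eps` = equality of collections. -/
  Eps : Type
  /-- ⟨CARRIER⟩ `e ↦ (e · Nm_{E_v/F_v} E_v^×)_v`, the collection generated by an element `e ∈ E^{×−}` (Def. 4.12, first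
  bullet, l. 2105: «`ε_v = e Nm_{E_v/F_v} E_v^×` for every nonarchimedean place `v` of `F`»); its values off `E^{×−}` are
  never used. -/
  epsOf : E → Eps
  /-- ⟨CARRIER⟩ the set of automorphic characters «`χ = ⊗ χ_v : E^1 \ (𝔸_E^∞)^1 → ℂ^×` (whose value is necessarily in `ℂ^1`)»
  (Def. 4.11, third bullet, l. 2090). -/
  Chi : Type
  /-- «Let `μ : E^× \ 𝔸_E^× → ℂ^×` be a conjugate symplectic character of weight one» (Def. 4.16, l. 2219; cf. Def. 4.5
  l. 1937) — the character itself, REAL: a continuous unitary character of the idele class group `C_E` (values in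
  `ℂ^1`, as printed in Def. 4.11, first bullet). -/
  μ : IdeleClassGroup E →ₜ* Circle
  /-- «conjugate symplectic» (Def. 4.1, l. 1901: «`μ|_{𝔸_F^×} = μ_{E/F}`»), the tree's `IdeleClassGroup.IsConjugateSymplectic`
  over `E⁺ ≃ F` (READING R1; the `IsCMField E` instance is `isCMField F E`). -/
  isConjugateSymplectic : letI : IsCMField E := isCMField F E; IdeleClassGroup.IsConjugateSymplectic E μ
  /-- «of weight one» (Def. 4.3 (1), l. 1917: «If `𝚠_μ` is a constant `m`, then we say that `μ` is of weight `m`»), the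
  tree's `IdeleClassGroup.HasWeight E μ 1`. -/
  hasWeight_one : letI : IsCMField E := isCMField F E; IdeleClassGroup.HasWeight E μ 1
  /-- ⟨CARRIER⟩ the objects `D_μ = (A_μ, i_μ, λ_μ, r_μ)` of «the category `𝒜(μ)` of CM data for `μ`» (Def. 4.5 (2)–(3),
  l. 1944–1960; «nonempty and connected partially ordered set», Prop. 4.6 (1), l. 1969 — not posited here). -/
  Obj : Type
  /-- ⟨CARRIER⟩ the underlying `ℂ`-vector space of «the adèlic oscillator representation attached to `(μ, ε, χ)`,
  `ω(μ, ε, χ) := ⊗'_v ω(μ_v, ε_v, χ_v)`, which is an irreducible admissible representation of `𝔾(𝔸_F^∞)`» (Def. 4.11,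
  l. 2092–2096), for the structure's `μ`. -/
  omega : Eps → Chi → Type
  [instAddCommGroupOmega : ∀ ε χ, AddCommGroup (omega ε χ)]
  [instModuleOmega : ∀ ε χ, Module ℂ (omega ε χ)]
  /-- ⟨CARRIER⟩ the action of `𝔾(𝔸_F^∞)` on `ω(μ, ε, χ)` (Def. 4.11). -/
  rho : ∀ ε χ, Representation ℂ G (omega ε χ)
  /-- ⟨CARRIER⟩ the `M_μ`-module «`Ω(μ) := colim_{D_μ ∈ 𝒜(μ)} Hom_E(A_∞, A_μ)_ℚ` in the category of
  `M_μ[𝔾(𝔸_F^∞)]`-modules» (Def. 4.16, l. 2221), «where `M_μ` acts via `i_μ`» (l. 2219); `M_μ = fieldOfValues E μ`.  By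
  Rem. 4.17 (l. 2227) «the canonical map `Hom_E(A_∞, A_μ)_ℚ → Ω(μ)` is an isomorphism» for every object `D_μ`. -/
  Ω : Type
  [instAddCommGroupΩ : AddCommGroup Ω]
  [instModuleΩ : Module (fieldOfValues E μ) Ω]
  /-- ⟨CARRIER⟩ the action of `𝔾(𝔸_F^∞)` on `Ω(μ)`: «`𝔾(𝔸_F^∞)` acts `M_μ`-linearly via its action on `A_∞`» (l. 2219),
  i.e. through «the Hecke correspondences … `𝔾(𝔸_F^∞) → Aut_E(A_∞)`» (l. 2074). -/
  rhoΩ : Representation (fieldOfValues E μ) G Ω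
  /-- ⟨CARRIER⟩ the additive group (a `ℚ`-vector space) `Hom_E(A_K, A_μ)_ℚ` of item (1) (l. 2239), for a subgroup
  `K ≤ 𝔾(𝔸_F^∞)` and an object `D_μ ∈ 𝒜(μ)` with abelian variety `A_μ`; `A_K = Alb_{X_K}`, `X_K = \tilde Sh(𝕍)_K`
  (l. 2062–2066), defined for `K` sufficiently small open compact (its values at other `K` are never used). -/
  HomK : Subgroup G → Obj → Type
  [instAddCommGroupHomK : ∀ K D, AddCommGroup (HomK K D)]
  /-- ⟨CARRIER⟩ the canonical map `Hom_E(A_K, A_μ)_ℚ → Ω(μ)`: composition with the projection `A_∞ → A_K` of the projective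
  system `{A_K}_K` (l. 2070–2072) into `Hom_E(A_∞, A_μ)_ℚ`, followed by the canonical map of Def. 4.16 / Rem. 4.17.
  READING R5: the «canonical isomorphism» of item (1) is the one induced by this map. -/
  res : ∀ K D, HomK K D →+ Ω

attribute [instance] Thm418Data.instGroup Thm418Data.instTopologicalSpace Thm418Data.instIsTopologicalGroup
  Thm418Data.instAddCommGroupOmega Thm418Data.instModuleOmega Thm418Data.instAddCommGroupΩ
  Thm418Data.instModuleΩ Thm418Data.instAddCommGroupHomK

namespace Thm418Data

variable {F E : Type} [Field F] [NumberField F] [IsTotallyReal F] [Field E] [NumberField E] [Algebra F E]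
  [IsTotallyComplex E] [Algebra.IsQuadraticExtension F E] (D : Thm418Data F E)

/-- `Φ_μ`, «the CM type of `μ`» (Def. 4.3 (2), l. 1919) of the structure's weight-one conjugate symplectic `μ`: the tree's
`IsConjugateSymplectic.cmType` (a `Motives.CMType E`, i.e. a set of embeddings `E →+* ℂ` with exactly one of each
conjugate pair). [cite: Liu2021, Def. 4.3 (2)] -/
def cmType : CMType E :=
  letI : IsCMField E := isCMField F E
  D.isConjugateSymplectic.cmType

/-- **`ε` is `μ`-admissible** (Def. 4.12, l. 2102–2108): «there exists some `e ∈ E^{×−}` such that • `ε_v = e Nm_{E_v/F_v}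
E_v^×` for every nonarchimedean place `v` of `F`, and • `τ'(e)` has negative imaginary part for every `τ' ∈ Φ_μ`» — the
element `e` through the tree's `IsAdmissibleElement E Φ_μ e` (`e ≠ 0`, `\bar e = −e`, `Im τ'(e) < 0` for `τ' ∈ Φ_μ`), the
collection through the carrier `epsOf`. [cite: Liu2021, Def. 4.12] -/
def IsAdmissible (ε : D.Eps) : Prop :=
  letI : IsCMField E := isCMField F E
  ∃ e : E, IsAdmissibleElement E D.cmType.1 e ∧ D.epsOf e = ε

/-- The index set of the direct sum of Thm. 4.18: «all `ε, χ` such that `ε` is `μ`-admissible» (l. 2237).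
[cite: Liu2021, Thm. 4.18] -/
def AdmIndex : Type :=
  {p : D.Eps × D.Chi // D.IsAdmissible p.1}

/-- `ω_i = ω(μ, ε, χ)` for an index `i = (ε, χ)`. [cite: Liu2021, Thm. 4.18] -/
abbrev omegaAt (i : D.AdmIndex) : Type := D.omega i.1.1 i.1.2

/-- The action of `g ∈ 𝔾(𝔸_F^∞)` on `ω_i`. [cite: Liu2021, Def. 4.11] -/
abbrev rhoAt (i : D.AdmIndex) : Representation ℂ D.G (D.omegaAt i) := D.rho i.1.1 i.1.2

/-- The `K`-invariants `Ω(μ)^K` of a subgroup `K ≤ 𝔾(𝔸_F^∞)` in `Ω(μ)` (item (1), l. 2239: «`Ω(μ)^K`»), as a set.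
[cite: Liu2021, Thm. 4.18 (1)] -/
def invariants (K : Subgroup D.G) : Set D.Ω :=
  {x | ∀ k ∈ K, D.rhoΩ k x = x}

/-- **The action of `σ ∈ Gal(ℂ/M_μ)` on `Ω(μ) ⊗_{M_μ} ℂ`** (item (3)): `σ ⊗ 1` on Mathlib's `ℂ ⊗[M_μ] Ω(μ)`, for
`σ : ℂ ≃ₐ[M_μ] ℂ` an automorphism of `ℂ` fixing `M_μ` (an `M_μ`-linear map of `ℂ`, tensored with `Ω(μ)`).  READING R4.
[cite: Liu2021, Thm. 4.18 (3)] -/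
def galoisAct (σ : ℂ ≃ₐ[fieldOfValues E D.μ] ℂ) :
    ℂ ⊗[fieldOfValues E D.μ] D.Ω →ₗ[fieldOfValues E D.μ] ℂ ⊗[fieldOfValues E D.μ] D.Ω :=
  σ.toLinearMap.rTensor D.Ω

/-- «isomorphic `ℂ[𝔾(𝔸_F^∞)]`-modules» for two summands (item (2), l. 2241): a `ℂ`-linear equivalence intertwining the
`G`-actions exists. READING R6. [cite: Liu2021, Thm. 4.18 (2)] -/
def AreIsomorphic (i j : D.AdmIndex) : Prop :=
  ∃ f : D.omegaAt i ≃ₗ[ℂ] D.omegaAt j, ∀ (g : D.G) (v : D.omegaAt i), f (D.rhoAt i g v) = D.rhoAt j g (f v)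

end Thm418Data

/-! ## Theorem 4.18, exactly as printed -/

/-- **[Liu2021, Theorem 4.18] EXACTLY AS PRINTED** (`FJcycle.tex` l. 2232–2245 = `paper:arxiv-2102.11518` p0022 L59–70),
for the datum `D` (standing hypotheses l. 1878: `F` totally real, `E/F` totally imaginary quadratic — the instance
arguments; l. 2053: `n ≥ 2`, `𝕍`/`𝔾(𝔸_F^∞)`; Def. 4.16 l. 2219: `μ` conjugate symplectic of weight one; the carriers of
`Thm418Data`):

«There is an isomorphism `Ω(μ) ⊗_{M_μ} ℂ ≃ ⊕_ε ⊕_χ ω(μ, ε, χ)` of `ℂ[𝔾(𝔸_F^∞)]`-modules, where the direct sum is taken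
over all `ε, χ` such that `ε` is `μ`-admissible. Moreover, (1) For every object `D_μ = (A_μ, i_μ, λ_μ, r_μ) ∈ 𝒜(μ)`, we
have a canonical isomorphism `Ω(μ)^K ≃ Hom_E(A_K, A_μ)_ℚ` for every sufficiently small open compact subgroup
`K ⊆ 𝔾(𝔸_F^∞)`. (2) The `ℂ[𝔾(𝔸_F^∞)]`-modules in the direct sum in Theorem 4.18 are mutually non-isomorphic. (3) For every
given `ε` that is `μ`-admissible, the subspace `⊕_χ ω(μ, ε, χ)` is stable under the action of `Gal(ℂ/M_μ)`.»

TYPED as the conjunction, under ONE isomorphism `Φ` (an existential, as printed «There is an isomorphism»), of: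
(main) `Φ : ℂ ⊗[M_μ] Ω(μ) ≃ₗ[ℂ] ⨁_{(ε,χ), ε μ-admissible} ω(μ,ε,χ)` intertwines `g ⊗ 1`-on-`Ω(μ)` (base change of `rhoΩ g`)
with the componentwise action of `g`; (1) `∀ D_μ ∈ 𝒜(μ)`, `∃ K₀` open compact, `∀ K` open compact `≤ K₀`, the canonical
map `res K D_μ : Hom_E(A_K, A_μ)_ℚ → Ω(μ)` is injective with image `Ω(μ)^K`; (2) indices with isomorphic summands are
equal; (3) `∀ ε` `μ`-admissible, `∀ σ ∈ Gal(ℂ/M_μ)`, `∀ x`, if `Φ x` is supported on the indices `(ε, ·)` then so is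
`Φ (σ · x)`.  READINGS R1–R6 of the module docstring; no hypothesis added, none dropped (in particular no `n ≥ 3`, no
`τ' ∈ Φ_μ`, no condition on `[F:ℚ]`, no Galois / signature / compactness / ramification condition — none is printed).
A consumer takes `(h : Thm418AsPrinted D)` for ITS OWN `D`; `∀ D, Thm418AsPrinted D` is not the theorem and is not
claimed.  NO PROOF (Track 2). [cite: Liu2021, Thm. 4.18] -/
def Thm418AsPrinted {F E : Type} [Field F] [NumberField F] [IsTotallyReal F] [Field E] [NumberField E] [Algebra F E]
    [IsTotallyComplex E] [Algebra.IsQuadraticExtension F E] (D : Thm418Data F E) : Prop :=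
  ∃ Φ : (ℂ ⊗[fieldOfValues E D.μ] D.Ω) ≃ₗ[ℂ] (⨁ i : D.AdmIndex, D.omegaAt i),
    -- «isomorphism … of ℂ[𝔾(𝔸_F^∞)]-modules» (l. 2233–2237)
    (∀ (g : D.G) (x : ℂ ⊗[fieldOfValues E D.μ] D.Ω) (i : D.AdmIndex),
        Φ ((D.rhoΩ g).baseChange ℂ x) i = D.rhoAt i g (Φ x i)) ∧
    -- (1) (l. 2239)
    (∀ Dμ : D.Obj, ∃ K₀ : Subgroup D.G, IsOpenCompact K₀ ∧
        ∀ K : Subgroup D.G, IsOpenCompact K → K ≤ K₀ →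
          Function.Injective (D.res K Dμ) ∧ Set.range (D.res K Dμ) = D.invariants K) ∧
    -- (2) (l. 2241)
    (∀ i j : D.AdmIndex, D.AreIsomorphic i j → i = j) ∧
    -- (3) (l. 2243)
    (∀ ε : D.Eps, D.IsAdmissible ε → ∀ (σ : ℂ ≃ₐ[fieldOfValues E D.μ] ℂ) (x : ℂ ⊗[fieldOfValues E D.μ] D.Ω),
        (∀ i : D.AdmIndex, i.1.1 ≠ ε → Φ x i = 0) → ∀ i : D.AdmIndex, i.1.1 ≠ ε → Φ (D.galoisAct σ x) i = 0)

namespace Thm418Data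

variable {F E : Type} [Field F] [NumberField F] [IsTotallyReal F] [Field E] [NumberField E] [Algebra F E]
  [IsTotallyComplex E] [Algebra.IsQuadraticExtension F E] {D : Thm418Data F E}

/-- Dot-notation alias: `D.Thm418AsPrinted`. [cite: Liu2021, Thm. 4.18] -/
protected abbrev Thm418AsPrinted (D : Thm418Data F E) : Prop := Liu2021.Thm418AsPrinted D

/-- Unfolding of `Ω(μ)^K` (item (1), l. 2239). [cite: Liu2021, Thm. 4.18 (1)] -/
theorem mem_invariants_iff (K : Subgroup D.G) (x : D.Ω) : x ∈ D.invariants K ↔ ∀ k ∈ K, D.rhoΩ k x = x :=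
  Iff.rfl

/-- The Galois action of item (3) is `σ` on the scalar factor: `σ · (z ⊗ y) = σ(z) ⊗ y` (READING R4).
[cite: Liu2021, Thm. 4.18 (3)] -/
theorem galoisAct_tmul (σ : ℂ ≃ₐ[fieldOfValues E D.μ] ℂ) (z : ℂ) (y : D.Ω) :
    D.galoisAct σ (z ⊗ₜ y) = σ z ⊗ₜ y :=
  LinearMap.rTensor_tmul D.Ω σ.toLinearMap y z

/-- Bookkeeping consequence of item (2) alone, in the shape of the tree's `LiuAlbaneseDatum.Thm418_2` (injectivity of the
index-to-module map on `μ`-admissible pairs): two admissible indices with isomorphic `ω` are equal. [cite: Liu2021, Thm. 4.18 (2)] -/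
theorem eq_of_areIsomorphic (h : Liu2021.Thm418AsPrinted D) {i j : D.AdmIndex} (hij : D.AreIsomorphic i j) : i = j := by
  obtain ⟨_, _, _, h2, _⟩ := h
  exact h2 i j hij

/-- Bookkeeping consequence of item (1): for every object `D_μ` there is an open compact `K₀` at which the canonical map
`Hom_E(A_{K₀}, A_μ)_ℚ → Ω(μ)` is injective («sufficiently small» instantiated at `K₀` itself). [cite: Liu2021, Thm. 4.18 (1)] -/
theorem exists_injective_res (h : Liu2021.Thm418AsPrinted D) (Dμ : D.Obj) :
    ∃ K₀ : Subgroup D.G, IsOpenCompact K₀ ∧ Function.Injective (D.res K₀ Dμ) := by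
  obtain ⟨_, _, h1, _, _⟩ := h
  obtain ⟨K₀, hK₀, hK⟩ := h1 Dμ
  exact ⟨K₀, hK₀, (hK K₀ hK₀ le_rfl).1⟩

/-- **The binder list is inhabited** (hypothesis non-vacuity, not a statement about Liu's objects): over every CM
extension `E/F` as in l. 1878 the REAL hypotheses of the datum are jointly satisfiable — a conjugate symplectic idele
class character of weight one EXISTS (tree `IdeleClassGroup.exists_isConjugateSymplectic_hasCMType`, at the CM type
`cmTypeOf E (−1)` of the CM field `E`) — while the carriers are instantiated trivially (`G := PUnit`, one-point index
types, zero modules, `n := 2`, `𝕍 := PUnit`).  Our bookkeeping. [cite: Liu2021, Def. 4.3 and Def. 4.16] -/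
theorem nonempty (F E : Type) [Field F] [NumberField F] [IsTotallyReal F] [Field E] [NumberField E] [Algebra F E]
    [IsTotallyComplex E] [Algebra.IsQuadraticExtension F E] : Nonempty (Thm418Data F E) := by
  letI : IsCMField E := isCMField F E
  obtain ⟨μ, hμ, hw, -⟩ := IdeleClassGroup.exists_isConjugateSymplectic_hasCMType (L := E)
    (IdeleClassGroup.cmTypeOf E (fun _ => -1) (by simp))
  exact ⟨⟨2, le_rfl, PUnit, PUnit, PUnit, fun _ => PUnit.unit, PUnit, μ, hμ, hw, PUnit, fun _ _ => PUnit, fun _ _ => 1, PUnit, 1,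
    fun _ _ => PUnit, fun _ _ => 0⟩⟩

end Thm418Data

end Literature.NumberTheory.Automorphic.Liu2021

end
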